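import Summits.CriticalPhenomena.SAWScalingLimit.Theorems.SAWDevelopingMapHexConjectureKPTransfer
import HarnessLib

/-!
# Crux `HexConjecture` (stmt-CriticalPhenomena-0808), line `root-locality-replaces-loewner`:
the pointwise-in-`R` transfer of the confined strip bound to the window two-point lower bound

Landing target:
`Summits/CriticalPhenomena/SAWScalingLimit/Theorems/SAWDevelopingMapHexConjectureKPTransferAt.lean`
(`--supports stmt-CriticalPhenomena-0808`; registered stub `stub_kp_transfer_at`).

`stub_kp_transfer` (file `…KPTransfer`) turns the GLOBAL confined strip bound
`∃ c > 0, ∀ T ≥ 1, c · triDl (9T) ≤ W T` into the WINDOW TWO-POINT LOWER BOUND with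
`θ_a = 1/168`, `θ_b = 1/4`, `C = c⁻¹`, `R₀ = 600`.  Here `W T` is the `x_c`-mass of the coded
mid-edge walks of the Duminil-Copin–Smirnov strip `S_{32T+1,32T+1}` from the root to the floor
mid-edges at abscissae `d ∈ [T, 21T]`.  This file is the POINTWISE version: for a given
`R ≥ 600` only the strip bound at the single scale `T = ⌈R/168⌉` is assumed, and the conclusion
is the window inequality at that `R`,
`triDl ⌊R/4⌋ ≤ c⁻¹ · Σ_{d ∈ S'} Z_B(s_x → t_{x + d e₀})` for the upper half-box
`B = {v : rows ≥ x₁, |c_v - mid s_x| ≤ R}` and the lattice window `S' = [R/168, R/4] ∩ ℤ`.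
The proof is the same purely geometric chain:

* `9T ≤ ⌊R/4⌋`, so `triDl ⌊R/4⌋ ≤ triDl (9T) ≤ c⁻¹ W T` (`triDl_antitone`,
  `kpTransfer_nine_mul_ceil_le_floor`);
* each coded sum at offset `d ∈ [T, 21T]` is the arch mass `Z_{S_x(32T)}(s_x → t_{x + d e₀})` of
  the half-strip `S_x(32T)` (`archMass_halfStrip_offset`);
* `S_x(32T) ⊆ B` since `128 T + 4 ≤ R` (`kpTransfer_halfStrip_subset_halfBox`), so
  `Z_{S_x(32T)} ≤ Z_B` (`archMass_mono`);
* `[T, 21T] ⊆ S'` (`kpTransfer_Icc_subset_window`) and arch masses are nonnegative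
  (`archMass_nonneg`).
-/

noncomputable section

open scoped BigOperators Topology Classical
open Literature.Probability.LatticeModels (HexVertex hexGraph hexCenter Site)
open Literature.Probability.RandomPlanarGeometry
open Literature.Probability.RandomPlanarGeometry.SAW
open Literature.Probability.RandomPlanarGeometry.SAW.HV
open Summit.CriticalPhenomena.SAWScalingLimit.Theorems.ObservableToSLE.FloorRatio

namespace Summit.CriticalPhenomena.SAWScalingLimit.Theorems.HexConjecture.RootLocality

/-- **Registered sub-goal `stub_kp_transfer_at`** (crux item stmt-CriticalPhenomena-0808, line
`root-locality-replaces-loewner`): the pointwise-in-`R` geometric transfer from the confined strip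
bound to the WINDOW TWO-POINT LOWER BOUND.  If `W T` is the `x_c`-mass of the coded mid-edge walks
of the strip `S_{32T+1,32T+1}` from the root to the floor mid-edges at abscissae `d ∈ [T, 21T]`,
`c > 0`, `R ≥ 600` and `c · triDl (9T) ≤ W T` at the scale `T = ⌈R/168⌉`, then for every cell `x`,
the upper half-box `B = {v : rows ≥ x₁, |c_v - mid s_x| ≤ R}` and the lattice window
`S' = [R/168, R/4] ∩ ℤ`, `triDl ⌊R/4⌋ ≤ c⁻¹ · Σ_{d ∈ S'} Z_B(s_x → t_{x + d e₀})` — by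
monotonicity of `triDl` (`9T ≤ ⌊R/4⌋`), translation invariance (`archMass_halfStrip_offset`),
exact restriction (`archMass_mono`, `S_x(32T) ⊆ B`) and the inclusion of the windows
`[T, 21T] ⊆ S'`.
[cite: KrachunPanagiotis2026, §3 (Corollary 3.1: the window `G_k`, `k ∈ [T, 21T]`)] -/
theorem stub_kp_transfer_at : ∀ (W : ℕ → ℝ), (∀ T : ℕ, W T = ∑ d ∈ Finset.Icc (T : ℤ) (21 * T), ∑ P ∈ (Literature.Probability.RandomPlanarGeometry.SAW.HV.midWalks (Literature.Probability.RandomPlanarGeometry.SAW.HV.stripV (32 * T + 1) (32 * T + 1))).filter (fun P => Literature.Probability.RandomPlanarGeometry.SAW.HV.finalDart P = ((d, 0, false), (d, -1, true)) ∨ Literature.Probability.RandomPlanarGeometry.SAW.HV.finalDart P = ((d, -1, true), (d, 0, false))), Literature.Probability.RandomPlanarGeometry.SAW.hexCriticalFugacity ^ Literature.Probability.RandomPlanarGeometry.SAW.HV.mwLen P) → ∀ (c R : ℝ), 0 < c → 600 ≤ R → c * Literature.Probability.RandomPlanarGeometry.SAW.HV.triDl (9 * ⌈R / 168⌉₊)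 ≤ W ⌈R / 168⌉₊ → ∀ (x : Literature.Probability.LatticeModels.Site 2) (B : Finset Literature.Probability.LatticeModels.HexVertex) (S' : Finset ℤ), (∀ v : Literature.Probability.LatticeModels.HexVertex, v ∈ B ↔ (x 1 ≤ v.1 1 ∧ dist (Literature.Probability.LatticeModels.hexCenter v) (Literature.Probability.RandomPlanarGeometry.SAW.hexMidpoint s((x - Pi.single 1 1, 1), (x, 0))) ≤ R)) → (∀ d : ℤ, d ∈ S' ↔ ((1 / 168 : ℝ) * R ≤ (d : ℝ) ∧ (d : ℝ) ≤ (1 / 4 : ℝ) * R)) → Literature.Probability.RandomPlanarGeometry.SAW.HV.triDl ⌊R / 4⌋₊ ≤ c⁻¹ * ∑ d ∈ S', ∑ γ : Literature.Probability.RandomPlanarGeometry.SAW.HexMidEdgeSAW B s((x - Pi.single 1 1, 1), (x, 0)) s((x + Pi.single 0 d - Pi.single 1 1, 1), (x + Pi.single 0 d, 0)), Literature.Probability.RandomPlanarGeometry.SAW.hexCriticalFugacity ^ γ.length := by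
  intro W hW c R hc hR hcW x B S' hB hS'
  have hwin := kpTransfer_Icc_subset_window (R := R) (by linarith) hS'
  have h9 := kpTransfer_nine_mul_ceil_le_floor (R := R) (by linarith)
  have hTlt : ((⌈R / 168⌉₊ : ℕ) : ℝ) < R / 168 + 1 := Nat.ceil_lt_add_one (by positivity)
  set T : ℕ := ⌈R / 168⌉₊
  -- the half-strip `S_x(32T)` and its inclusion in the half-box
  set HS := (stripV (32 * T + 1) (32 * T + 1)).map
    (hvIso.trans (shift (-(x 0)) (-(x 1)))).symm.toEquiv.toEmbedding
  have hsub : HS ⊆ B := kpTransfer_halfStrip_subset_halfBox x T (by linarith) hB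
  set s : Sym2 HexVertex := s((x - Pi.single 1 1, 1), (x, 0))
  have hc' : (0 : ℝ) ≤ c⁻¹ := inv_nonneg.2 hc.le
  calc triDl ⌊R / 4⌋₊ ≤ triDl (9 * T) := triDl_antitone h9
    _ = c⁻¹ * (c * triDl (9 * T)) := (inv_mul_cancel_left₀ hc.ne' _).symm
    _ ≤ c⁻¹ * W T := mul_le_mul_of_nonneg_left hcW hc'
    _ = c⁻¹ * ∑ d ∈ Finset.Icc (T : ℤ) (21 * T), ∑ γ : HexMidEdgeSAW HS s
            s((x + Pi.single 0 d - Pi.single 1 1, 1), (x + Pi.single 0 d, 0)),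
            hexCriticalFugacity ^ γ.length := by
        rw [hW T]
        refine congrArg (fun t : ℝ => c⁻¹ * t) (Finset.sum_congr rfl fun d hd => ?_)
        rw [Finset.mem_Icc] at hd
        have hd' : |d| ≤ ((32 * T : ℕ) : ℤ) + 1 := by
          rw [abs_le]; push_cast; constructor <;> omega
        exact (archMass_halfStrip_offset x (32 * T) d hd').symm
    _ ≤ c⁻¹ * ∑ d ∈ Finset.Icc (T : ℤ) (21 * T), ∑ γ : HexMidEdgeSAW B s
            s((x + Pi.single 0 d - Pi.single 1 1, 1), (x + Pi.single 0 d, 0)),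
            hexCriticalFugacity ^ γ.length :=
        mul_le_mul_of_nonneg_left (Finset.sum_le_sum fun d _ => archMass_mono hsub s _) hc'
    _ ≤ c⁻¹ * ∑ d ∈ S', ∑ γ : HexMidEdgeSAW B s
            s((x + Pi.single 0 d - Pi.single 1 1, 1), (x + Pi.single 0 d, 0)),
            hexCriticalFugacity ^ γ.length :=
        mul_le_mul_of_nonneg_left
          (Finset.sum_le_sum_of_subset_of_nonneg hwin fun d _ _ => archMass_nonneg _ _ _) hc'

end Summit.CriticalPhenomena.SAWScalingLimit.Theorems.HexConjecture.RootLocality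

end
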